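import Literature.MathematicalPhysics.QuantumFieldTheory.Balaban1983to89.B3Eq119ChargeOrders
import Literature.MathematicalPhysics.QuantumFieldTheory.Balaban1983to89.B3Eq119ConnectedGraphs

/-!
# `Balaban1983to89.B3Eq119ChargedGraphs` — T. Bałaban, *(Higgs)₂,₃ quantum fields in a finite volume. III.
# Renormalization*, Commun. Math. Phys. **88** (1983) 411–445 [Balaban1983Higgs3], (1.19)–(1.21) p. 416: «the only vertices
# are (1.6), (1.7), (1.8), and (1.10) with n′ = 0, B̃ = 0, g_k = 1 … The propagators are C^ε_0 for the scalar field and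
# C^ε = (−Δ^ε + μ₀²)^{−1} for the vector field» — THE CHARGE-FREE COEFFICIENTS OF THE `e > 0` EXPANSION OF (1.19) ARE SUMS
# OVER CONNECTED GRAPHS WITH BOTH PROPAGATORS (the joint `e = 0` Gaussian of `(A, φ)` as p13's `gexp`, print's vertices as
# BRICK 5's polynomial clusters, BRICK 5's engine `ursellOf_jmoment_univ`)

statement-level skeleton of published theorems with citation tags; proofs where landed; nothing here is a claim about
the Yang–Mills mass gap

CITATION HEADER (lean-in-tree rule).  Part of the lit-balaban TYPED SKELETON (HOME `run/shared/lean/pub/lit-balaban/`),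
Phase 2, proof seat p33 (gen 72; v1.1 = doc-only requote, gen 73, declarations byte-identical; unit `lit-balaban-p33`); row
**B3.Eq1.19-1.22** of `HOME/lit-balaban-r15/ROWS-B3.md` (fold owner r15; head `proved` under the lead's HEAD WORD Q25/Q28 —
this file is an OPTIONAL located member of the (1.19)/(1.21) cell,
zero head weight; it supplies the «e > 0 two-propagator graph evaluation» named as NOT in the tree by the Q28 clause, for the
charge-free coefficients `U_z` of FILE 2 `B3Eq119ChargeOrders`).  REUSED BY NAME, nothing re-declared and nothing of another
seat modified: p34's integration coordinates `B1Eq221Coordinates.fieldCoord` / `fieldCoordM` / `measurePreserving_fieldCoordM` /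
`formMatrix` / `formMatrix_form` / `formMatrix_transpose` / `sum_inner_eq_dotProduct`; gen 71's (this seat's)
`B3Eq119ConnectedGraphs.{Crd, fc, precMat, precMat_posDef, weight_precMat, legV, dotProduct_legV, vecAction,
action_free_eq_of_charge_zero, prop0, prop0_eq_inv, norm_sq_eq_sum}`; p13's Gaussian with source
`BIJ88TruncationConnected306.gexp` / `B2Eq228Conditioning.weight`; BRICK 5's `B3GaussianPerturbationGraphs.{clusterVar, legProd,
jmoment, Leg, legVec, pairW, ursellOf_jmoment_univ, gexp_two_legs, gexp_zero_source, present, prod_present_eq}`; FILE 2's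
`B3Eq119ChargeOrders.{VType, Genuine, vtx, chargeOne, colourMoment, vfamily, coefX}`; BRICK 4's `freeMeasure`,
`integral_freeMeasure`; the typer's `HiggsLattice` carrier and analytic vertices `B3Eq18VertexExpansion.vertex16 … vertex110`,
`leg18`, `leg110`; Mathlib's `MeasurableEquiv.sumPiEquivProdPi` / `volume_measurePreserving_sumPiEquivProdPi_symm`,
`Matrix.fromBlocks`.

THE PRINT (p. 416 = PDF 6 of the held text `paper:balaban1983-higgs-2-3-quantum-fields-finite-volume`, L17–21, re-read this
session): «Here we have a graphical description of the same type as in (1.17), but with some simplifications. We have η = ε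
(hence L^kε = 1) and the only vertices are (1.6), (1.7) [with δm² instead of δm_i²(x)], (1.8), and (1.10) with n′ = 0, B̃ = 0,
g_k = 1 (but without any restrictions on n). The propagators are C^ε_0 for the scalar field and C^ε = (−Δ^ε + μ₀²)^{−1} for
the vector field (of course internal indices and vector indices are understood here)»; p. 414 (PDF 4, L38–41, verbatim;
v1.1 requote, ref-4 D-g71-2 — v1.0 carried here a gloss of ours inside quotation marks, which is NOT printed): «All the
A′-legs are contracted, i.e. they are divided into pairs and each pair is replaced by the corresponding propagator. Some
φ′-legs are replaced by external scalar fields and the remaining are again divided into pairs and each pair is replaced by a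
propagator».  (Gloss, ours, not print: the pairing is the Gaussian integral over `A′, φ′` — here, at `e = 0`, the joint
Gaussian `ν⁰` of §2 — and «the corresponding propagator» is its covariance, §6.)

THE ARGUMENT (ours).  §1–§2: at `e = 0` the free action (1.20) is `½⟨A,(−Δ^ε+μ₀²)A⟩ + ½⟨φ,(−Δ^ε_0+m²)φ⟩`
(`action_free_eq_of_charge_zero`); in p34's orthonormal integration coordinates of BOTH fields (`fieldCoord ℝ (bonds)` for
`A`, `fieldCoord ℝ^N (sites)` for `φ`, glued by `sumPiEquivProdPi`, all measure preserving) the free measure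
`ν⁰ = exp(−S^ε_{0,(m²,0,μ₀²,0)})dAdφ` is the centred Gaussian with the BLOCK-DIAGONAL positive-definite precision matrix
`jprec = precA ⊕ precMat` (`weight_jprec`, `jprec_posDef`), so `⟨G⟩_{ν⁰} = gexp jprec 0 (G ∘ jc⁻¹)` (`expectJ_eq_gexp`).  §3: the
quantities entering print's vertices are LINEAR functionals of the coordinates — `φ_a(x)` (`sLeg`), `A_b` (`aLeg`),
`(∂^εφ)_a(b) = ε⁻¹(φ_a(b₊) − φ_a(b₋))` (`dLeg`, the leg `D^ε_{B̃}φ′` at `B̃ = 0`), `(q^jφ(x))_a = Σ_c (q^j)_{ac}φ_c(x)` (`qLeg`).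
§4: hence at unit charge the genuine vertex types of FILE 2 are POLYNOMIAL CLUSTERS in BRICK 5's sense: (1.6) =
`Σ_{y,a,c}(−λε^d)φ_a(y)²φ_c(y)²`, (1.7) = `Σ_{y,a}(−½δm²ε^d)φ_a(y)²`, (1.8)_{i+1,0} = `Σ_{b,a} coef·(∂φ)_a(b)(q^{i+1}φ(b₋))_a A_b^{i+1}`,
(1.10)_{i+1,0} = `Σ_{b,a} coef·φ_a(b₋)(q^{i+1}φ(b₋))_a A_b^{i+1}` (`clusterVar_some`), and the observable `φ_{a₀}(x₀)φ_{b₀}(x₀′)` is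
the pin cluster; so FILE 2's colour moments of a genuine colouring `z` are BRICK 5's cluster moments `jmoment jprec (vK z)`
(`colourMoment_eq_jmoment`).  §5: BRICK 5's `ursellOf_jmoment_univ` then evaluates `U_z = ⟨φφ; X_{z_1}(1); …; X_{z_n}(1)⟩ᵀ_{ν⁰}`
as the sum over the inner colourings and the CONNECTED Wick pairings of the legs of `Π coef · Π_{pairs} ⟨jprec⁻¹ v_l, v_{l′}⟩`
(`coefX_chargeOne_eq_sum_connected`).  §6: `jprec⁻¹ = precA⁻¹ ⊕ precMat⁻¹`, so a pair of scalar legs carries gen 71's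
`C^ε_0 = prop0` (Green's function of `−Δ^ε_0 + m²`, `B3Eq119ConnectedGraphs.freeOp_propCol`), a pair of vector legs carries
`C^ε(b,b′) = ⟨A_bA_{b′}⟩_{ν⁰}` (`propA`, `propA_eq_expectJ`), a mixed pair carries `0`; composite legs pair bilinearly.

WHAT IS PROVED (sorry-free; any lattice level `k`; `[DecidableEq (PBond P k)]` supplied by the user):
* §1 `dA`, **`vecForm`** (`⟨A,(−Δ^ε+μ₀²)A′⟩` as a bilinear map), `vecForm_self` (= `2·vecAction`), **`precA`**, `precA_posDef`,
  `weight_precA`.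
* §2 `JCrd`, **`jc`** / `jcInv` / `jcM`, `measurePreserving_jcM`, `integral_comp_jc`, **`jprec`**, `weight_jprec`, `jprec_posDef`,
  **`expectJ`**, **`expectJ_eq_gexp`**.
* §3 `sLeg`, `aLeg`, `dLeg`, `opEntry`, `qLeg` with `jc_dotProduct_*` (the legs ARE the field quantities).
* §4 `VCol`, `vdeg`, `vleg`, `vcoef`, `typeCols`, **`vK`**, `clusterVar_none`, `clusterVar_v16/v17/v18/v110`, **`clusterVar_some`**,
  `prod_clusterVar`, **`colourMoment_eq_jmoment`**.
* §5 **`coefX_chargeOne_eq_sum_connected`** (the headline) and its model instance `coefU_model_eq_sum_connected`.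
* §6 `jprec_inv`, **`propA`**, **`inv_sLeg_sLeg`** (= `prop0`), **`inv_aLeg_aLeg`** (= `propA`), `inv_sLeg_aLeg` (= 0),
  `propA_eq_expectJ`, `prop0_eq_expectJ`, `inv_dotProduct_bilinear`.

HONEST SCOPE.  (i) Only GENUINE colourings (types (1.6), (1.7), (1.8)_{j,0}, (1.10)_{j,0}, `j ≤ n̄`) are polynomial; the
R-colour of FILE 2 is not a cluster and its coefficients are only BOUNDED there (`abs_coefX_le`).  (ii) The graphs are BRICK 5's
`LegDiagram` connected diagrams on the legs (no symmetry factors «understanding that they are a part of the graphical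
description», no amputation, no 1PI decomposition (1.21), no Dyson resummation — those remain the typed content of the Q25/Q28
clause).  (iii) `C^ε` is presented as the covariance `precA⁻¹` of the free vector Gaussian and as the `ν⁰` two-point function of
the bond variables; its Green's-function equation for `−Δ^ε + μ₀²` (Feynman gauge, (1.20)) is not re-derived here (gen 71 did it
for `C^ε_0`).  (iv) Hypotheses `m² > 0`, `μ₀² > 0`; `δm²` held at its value; nothing about `ε → 0`.
-/

noncomputable section

open MeasureTheory Matrix Finset
open scoped BigOperators InnerProductSpace

namespace Literature.MathematicalPhysics.QuantumFieldTheory.Balaban1983to89.B3Eq119ChargedGraphs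

open HiggsLattice HiggsCovariance B1Eq221Coordinates B3Eq119VertexExpansion B3TwoPointPerturbativeCoefficients
  B3GaussianPerturbationGraphs B3Eq119ConnectedGraphs B3Eq119TotalVertexFamily B3Eq119ChargeOrders
open B3Eq18VertexExpansion (vertex16 vertex17 vertex18 vertex110 leg18 leg110)
open Literature.MathematicalPhysics.QuantumFieldTheory.BalabanImbrieJaffe1984to88.BIJ88TruncationConnected306 (gexp)
open Literature.MathematicalPhysics.QuantumFieldTheory.Balaban1983to89.B2Eq228Conditioning (weight)
open Literature.Probability.LatticeModels (ursellOf)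
open Literature.Probability.LatticeModels.LegDiagram (diags IsConn)

variable {P : HiggsLattice.Params} {k N : ℕ}

/-! ## §1 The free vector-field Gaussian `exp(−½⟨A,(−Δ^ε+μ₀²)A⟩)dA` in integration coordinates -/

/-- Integration coordinates of the vector configurations: `(bonds) × Fin 1` (p34's `fieldCoord` with `V = ℝ`).
[cite: Balaban1982Higgs1, p.605] -/
abbrev CrdA (P : HiggsLattice.Params) (k : ℕ) : Type := HiggsLattice.PBond P k × Idx ℝ

/-- The coordinate map of the vector field (an orthonormal relabelling of `A ↦ (A_b)_b`). [cite: Balaban1982Higgs1, p.605] -/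
abbrev fcA (P : HiggsLattice.Params) (k : ℕ) : HiggsLattice.VecField P k ≃ₗ[ℝ] (CrdA P k → ℝ) :=
  fieldCoord ℝ (HiggsLattice.PBond P k)

/-- The linear functional `A ↦ (∂^η A_μ)(b)` of the vector field. [cite: Balaban1982Higgs1, (1.11) p.605] -/
def dA (μ : Fin P.d) (b : HiggsLattice.PBond P k) : HiggsLattice.VecField P k →ₗ[ℝ] ℝ where
  toFun A := sderiv (A.comp μ) b
  map_add' A B := by
    simp only [sderiv, HiggsLattice.VecField.comp, Pi.add_apply, smul_eq_mul]
    ring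
  map_smul' c A := by
    simp only [sderiv, HiggsLattice.VecField.comp, Pi.smul_apply, smul_eq_mul, RingHom.id_apply]
    ring

/-- [cite: Balaban1982Higgs1, (1.11) p.605] -/
@[simp] theorem dA_apply (μ : Fin P.d) (b : HiggsLattice.PBond P k) (A : HiggsLattice.VecField P k) :
    dA μ b A = sderiv (A.comp μ) b := rfl

/-- **The bilinear form of the free vector action**: `⟨A,(−Δ^ε+μ₀²)A′⟩ = Σ_μΣ_b η^d (∂A_μ)(b)(∂A′_μ)(b) + μ₀²Σ_b η^d A_bA′_b`
(Feynman gauge, componentwise Laplacian (I.1.11)). [cite: Balaban1983Higgs3, (1.20) p.416] [cite: Balaban1982Higgs1, (1.11) p.605] -/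
def vecForm (P : HiggsLattice.Params) (k : ℕ) (mu0sq : ℝ) :
    HiggsLattice.VecField P k →ₗ[ℝ] HiggsLattice.VecField P k →ₗ[ℝ] ℝ :=
  ∑ μ : Fin P.d, ∑ b : HiggsLattice.PBond P k, (P.mesh k ^ P.d) • (LinearMap.mul ℝ ℝ).compl₁₂ (dA μ b) (dA μ b)
    + ∑ b : HiggsLattice.PBond P k,
        (P.mesh k ^ P.d * mu0sq) • (LinearMap.mul ℝ ℝ).compl₁₂ (LinearMap.proj b) (LinearMap.proj b)

/-- The formula of the vector form. [cite: Balaban1983Higgs3, (1.20) p.416] -/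
theorem vecForm_apply (mu0sq : ℝ) (A B : HiggsLattice.VecField P k) :
    vecForm P k mu0sq A B
      = ∑ μ : Fin P.d, ∑ b : HiggsLattice.PBond P k, P.mesh k ^ P.d * (sderiv (A.comp μ) b * sderiv (B.comp μ) b)
        + ∑ b : HiggsLattice.PBond P k, P.mesh k ^ P.d * mu0sq * (A b * B b) := by
  simp only [vecForm, LinearMap.add_apply, LinearMap.sum_apply, LinearMap.smul_apply, LinearMap.compl₁₂_apply,
    LinearMap.mul_apply', smul_eq_mul, dA_apply, LinearMap.coe_proj, Function.eval]

/-- On the diagonal the vector form is twice the free vector action `½⟨A,(−Δ^ε+μ₀²)A⟩`. [cite: Balaban1983Higgs3, (1.20) p.416] -/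
theorem vecForm_self (mu0sq : ℝ) (A : HiggsLattice.VecField P k) :
    vecForm P k mu0sq A A = 2 * vecAction P k mu0sq A := by
  rw [vecForm_apply, vecAction, vecLaplaceForm]
  have h1 : ∀ (μ : Fin P.d) (b : HiggsLattice.PBond P k),
      P.mesh k ^ P.d * (sderiv (A.comp μ) b * sderiv (A.comp μ) b) = P.mesh k ^ P.d * sderiv (A.comp μ) b ^ 2 :=
    fun μ b => by ring
  have h2 : ∀ b : HiggsLattice.PBond P k, P.mesh k ^ P.d * mu0sq * (A b * A b) = P.mesh k ^ P.d * (mu0sq * A b ^ 2) :=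
    fun b => by ring
  simp only [h1, h2]
  ring

/-- The vector form is symmetric. [cite: Balaban1983Higgs3, (1.20) p.416] -/
theorem vecForm_comm (mu0sq : ℝ) (A B : HiggsLattice.VecField P k) :
    vecForm P k mu0sq A B = vecForm P k mu0sq B A := by
  rw [vecForm_apply, vecForm_apply]
  simp only [mul_comm]

/-- The vector form dominates the mass term: `⟨A,(−Δ^ε+μ₀²)A⟩ ≥ μ₀² Σ_b η^d A_b²`. [cite: Balaban1982Higgs1, (1.11) p.605] -/
theorem vecForm_self_ge (mu0sq : ℝ) (A : HiggsLattice.VecField P k) :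
    mu0sq * ∑ b : HiggsLattice.PBond P k, P.mesh k ^ P.d * A b ^ 2 ≤ vecForm P k mu0sq A A := by
  rw [vecForm_apply]
  have h1 : 0 ≤ ∑ μ : Fin P.d, ∑ b : HiggsLattice.PBond P k,
      P.mesh k ^ P.d * (sderiv (A.comp μ) b * sderiv (A.comp μ) b) :=
    sum_nonneg fun μ _ => sum_nonneg fun b _ =>
      mul_nonneg (pow_nonneg (P.mesh_pos k).le _) (mul_self_nonneg _)
  have h2 : mu0sq * ∑ b : HiggsLattice.PBond P k, P.mesh k ^ P.d * A b ^ 2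
      = ∑ b : HiggsLattice.PBond P k, P.mesh k ^ P.d * mu0sq * (A b * A b) := by
    rw [mul_sum]; exact sum_congr rfl fun b _ => by ring
  linarith

section PrecA

variable [DecidableEq (HiggsLattice.PBond P k)]

/-- **The precision matrix of the free vector Gaussian** in integration coordinates. [cite: Balaban1983Higgs3, (1.20) p.416] -/
def precA (P : HiggsLattice.Params) (k : ℕ) [DecidableEq (HiggsLattice.PBond P k)] (mu0sq : ℝ) :
    Matrix (CrdA P k) (CrdA P k) ℝ :=
  formMatrix (vecForm P k mu0sq)

/-- `(fcA A)ᵀ·precA·(fcA B) = ⟨A,(−Δ^ε+μ₀²)B⟩`. [cite: Balaban1983Higgs3, (1.20) p.416] -/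
theorem dotProduct_precA_mulVec (mu0sq : ℝ) (A B : HiggsLattice.VecField P k) :
    fcA P k A ⬝ᵥ (precA P k mu0sq *ᵥ fcA P k B) = vecForm P k mu0sq A B :=
  formMatrix_form (vecForm P k mu0sq) A B

/-- `precA` is symmetric. [cite: Balaban1983Higgs3, (1.20) p.416] -/
theorem precA_transpose (mu0sq : ℝ) : (precA P k mu0sq)ᵀ = precA P k mu0sq :=
  formMatrix_transpose fun A B => vecForm_comm mu0sq A B

/-- **`precA` is positive definite** for `μ₀² > 0`. [cite: Balaban1983Higgs3, (1.20) p.416] -/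
theorem precA_posDef {mu0sq : ℝ} (hmu : 0 < mu0sq) : (precA P k mu0sq).PosDef := by
  refine Matrix.posDef_iff_dotProduct_mulVec.mpr ⟨?_, fun z hz => ?_⟩
  · rw [Matrix.IsHermitian, Matrix.conjTranspose_eq_transpose_of_trivial, precA_transpose]
  · set A : HiggsLattice.VecField P k := (fcA P k).symm z with hA
    have hz' : fcA P k A = z := by rw [hA, LinearEquiv.apply_symm_apply]
    have hA0 : A ≠ 0 := by
      intro h0; apply hz; rw [← hz', h0, map_zero]
    obtain ⟨b₀, hb₀⟩ : ∃ b, A b ≠ 0 := Function.ne_iff.mp hA0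
    have hη : 0 < P.mesh k ^ P.d := pow_pos (P.mesh_pos k) _
    have hsum : 0 < ∑ b : HiggsLattice.PBond P k, P.mesh k ^ P.d * A b ^ 2 :=
      lt_of_lt_of_le (mul_pos hη (pow_pos (abs_pos.2 hb₀) 2 |>.trans_eq (sq_abs _)))
        (single_le_sum (f := fun b => P.mesh k ^ P.d * A b ^ 2) (fun b _ => mul_nonneg hη.le (sq_nonneg _))
          (mem_univ b₀))
    simp only [star_trivial]
    rw [← hz', dotProduct_precA_mulVec]
    have h := vecForm_self_ge (P := P) (k := k) mu0sq A
    nlinarith [mul_pos hmu hsum]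

/-- The Gaussian weight of `precA` at `fcA A` is `exp(−½⟨A,(−Δ^ε+μ₀²)A⟩)`. [cite: Balaban1983Higgs3, (1.20) p.416] -/
theorem weight_precA (mu0sq : ℝ) (A : HiggsLattice.VecField P k) :
    weight (precA P k mu0sq) (fcA P k A) = Real.exp (-vecAction P k mu0sq A) := by
  rw [B2Eq228Conditioning.weight, dotProduct_precA_mulVec, vecForm_self]
  congr 1
  ring

end PrecA

/-! ## §2 The JOINT `e = 0` Gaussian of both fields in integration coordinates: `ν⁰`-expectations are `gexp` -/

/-- The joint integration coordinates: vector coordinates `⊕` scalar coordinates. [cite: Balaban1982Higgs1, p.605] -/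
abbrev JCrd (P : HiggsLattice.Params) (k N : ℕ) : Type := CrdA P k ⊕ Crd P k N

/-- The joint coordinate map `(A, φ) ↦ (fcA A, fc φ)`. [cite: Balaban1982Higgs1, p.605] -/
def jc (Φ : Cfg P k N) : JCrd P k N → ℝ := Sum.elim (fcA P k Φ.1) (fc P k N Φ.2)

/-- Its inverse. [cite: Balaban1982Higgs1, p.605] -/
def jcInv (z : JCrd P k N → ℝ) : Cfg P k N :=
  ((fcA P k).symm (fun i => z (Sum.inl i)), (fc P k N).symm (fun i => z (Sum.inr i)))

/-- [cite: Balaban1982Higgs1, p.605] -/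
theorem jc_comp_inl (Φ : Cfg P k N) : jc Φ ∘ Sum.inl = fcA P k Φ.1 := rfl

/-- [cite: Balaban1982Higgs1, p.605] -/
theorem jc_comp_inr (Φ : Cfg P k N) : jc Φ ∘ Sum.inr = fc P k N Φ.2 := rfl

/-- [cite: Balaban1982Higgs1, p.605] -/
theorem jc_jcInv (z : JCrd P k N → ℝ) : jc (jcInv z) = z := by
  funext i
  cases i with
  | inl a => simp [jc, jcInv]
  | inr b => simp [jc, jcInv]

/-- [cite: Balaban1982Higgs1, p.605] -/
theorem jcInv_jc (Φ : Cfg P k N) : jcInv (jc Φ) = Φ := by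
  unfold jcInv
  simp only [jc, Sum.elim_inl, Sum.elim_inr]
  rw [show (fun i => fcA P k Φ.1 i) = fcA P k Φ.1 from rfl, show (fun i => fc P k N Φ.2 i) = fc P k N Φ.2 from rfl,
    LinearEquiv.symm_apply_apply, LinearEquiv.symm_apply_apply]

/-- The joint coordinate map as a measurable equivalence (p34's `fieldCoordM` on both factors, then `(α→ℝ)×(β→ℝ) ≃ (α⊕β→ℝ)`).
[cite: Balaban1982Higgs1, p.605] -/
def jcM : Cfg P k N ≃ᵐ (JCrd P k N → ℝ) :=
  ((fieldCoordM ℝ (HiggsLattice.PBond P k)).prodCongr (fieldCoordM (E N) (HiggsLattice.Site P k))).trans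
    (MeasurableEquiv.sumPiEquivProdPi (fun _ : JCrd P k N => ℝ)).symm

/-- [cite: Balaban1982Higgs1, p.605] -/
theorem jcM_apply (Φ : Cfg P k N) : jcM Φ = jc Φ := by
  funext i
  cases i with
  | inl a => rfl
  | inr b => rfl

/-- [cite: Balaban1982Higgs1, p.605] -/
theorem jcM_symm_apply (z : JCrd P k N → ℝ) : (jcM (P := P) (k := k) (N := N)).symm z = jcInv z := by
  apply (jcM (P := P) (k := k) (N := N)).injective
  rw [MeasurableEquiv.apply_symm_apply, jcM_apply, jc_jcInv]

/-- **The joint coordinates preserve the Lebesgue measure `dA dφ`.** [cite: Balaban1982Higgs1, (1.10) p.605] -/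
theorem measurePreserving_jcM : MeasurePreserving (⇑(jcM (P := P) (k := k) (N := N))) volume volume :=
  (volume_measurePreserving_sumPiEquivProdPi_symm (fun _ : JCrd P k N => ℝ)).comp
    ((measurePreserving_fieldCoordM ℝ (HiggsLattice.PBond P k)).prod
      (measurePreserving_fieldCoordM (E N) (HiggsLattice.Site P k)))

/-- **Change of variables to joint coordinates**: `∫ H(A,φ) dAdφ = ∫ H(jc⁻¹ z) dz`. [cite: Balaban1982Higgs1, (1.10) p.605] -/
theorem integral_comp_jc (H : Cfg P k N → ℝ) : ∫ Φ, H Φ = ∫ z : JCrd P k N → ℝ, H (jcInv z) := by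
  rw [← ((measurePreserving_jcM (P := P) (k := k) (N := N)).symm _).integral_comp' (g := H)]
  simp_rw [jcM_symm_apply]

/-- The normalized `ν⁰`-expectation: `⟨G⟩_{ν⁰} = ∫ G dν⁰ / ν⁰(Ω)`. [cite: Balaban1983Higgs3, (1.19) p.416] -/
def expectJ (C : ChargeData N) (msq mu0sq : ℝ) (G : Cfg P k N → ℝ) : ℝ :=
  (∫ Φ, G Φ ∂(freeMeasure P k N (chargeZero C) msq mu0sq)) / (freeMeasure P k N (chargeZero C) msq mu0sq).real Set.univ

/-- `ν⁰(Ω) = ∫ 1 dν⁰`. [folklore] [cite: Balaban1983Higgs3, (1.19) p.416] -/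
theorem measureReal_univ_eq_integral (C : ChargeData N) (msq mu0sq : ℝ) :
    (freeMeasure P k N C msq mu0sq).real Set.univ = ∫ _Φ, (1 : ℝ) ∂(freeMeasure P k N C msq mu0sq) := by
  rw [integral_const, smul_eq_mul, mul_one]

section JPrec

variable [DecidableEq (HiggsLattice.PBond P k)]

/-- **The joint precision matrix** of the `e = 0` free measure: block-diagonal `precA ⊕ precMat` (the vector and scalar
free Gaussians are independent at `e = 0`). [cite: Balaban1983Higgs3, (1.20) p.416] -/
def jprec (P : HiggsLattice.Params) (k N : ℕ) [DecidableEq (HiggsLattice.PBond P k)] (C : ChargeData N) (msq mu0sq : ℝ) :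
    Matrix (JCrd P k N) (JCrd P k N) ℝ :=
  Matrix.fromBlocks (precA P k mu0sq) 0 0 (precMat (P := P) (k := k) (chargeZero C) msq)

/-- The joint quadratic form splits. [cite: Balaban1983Higgs3, (1.20) p.416] -/
theorem dotProduct_jprec_mulVec (C : ChargeData N) (msq mu0sq : ℝ) (z w : JCrd P k N → ℝ) :
    z ⬝ᵥ (jprec P k N C msq mu0sq *ᵥ w)
      = (z ∘ Sum.inl) ⬝ᵥ (precA P k mu0sq *ᵥ (w ∘ Sum.inl))
        + (z ∘ Sum.inr) ⬝ᵥ (precMat (P := P) (k := k) (chargeZero C) msq *ᵥ (w ∘ Sum.inr)) := by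
  rw [jprec, fromBlocks_mulVec, zero_mulVec, zero_mulVec, add_zero, zero_add]
  conv_lhs => rw [← Sum.elim_comp_inl_inr z]
  rw [sumElim_dotProduct_sumElim]

/-- **The joint Gaussian weight is the free action at `e = 0`**: `exp(−½ (jcΦ)ᵀ·jprec·(jcΦ)) = exp(−S^ε_{0,(m²,0,μ₀²,0)}(A,φ))`.
[cite: Balaban1983Higgs3, (1.20) p.416] -/
theorem weight_jprec (C : ChargeData N) (msq mu0sq : ℝ) (Φ : Cfg P k N) :
    weight (jprec P k N C msq mu0sq) (jc Φ) = Real.exp (-action (chargeZero C) ⟨msq, 0, mu0sq, 0⟩ Φ.1 Φ.2) := by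
  rw [B2Eq228Conditioning.weight, dotProduct_jprec_mulVec, jc_comp_inl, jc_comp_inr, dotProduct_precA_mulVec, vecForm_self,
    action_free_eq_of_charge_zero (chargeZero C) rfl]
  have h := weight_precMat (P := P) (k := k) (chargeZero C) msq Φ.2
  rw [B2Eq228Conditioning.weight] at h
  rw [show -(1 / 2 : ℝ) * (2 * vecAction P k mu0sq Φ.1 + fc P k N Φ.2 ⬝ᵥ precMat (chargeZero C) msq *ᵥ fc P k N Φ.2)
      = -vecAction P k mu0sq Φ.1 + -(1 / 2 : ℝ) * (fc P k N Φ.2 ⬝ᵥ precMat (chargeZero C) msq *ᵥ fc P k N Φ.2) by ring,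
    Real.exp_add, h, ← Real.exp_add, neg_add]

/-- **The joint precision matrix is positive definite** (`m² > 0`, `μ₀² > 0`). [cite: Balaban1983Higgs3, (1.20) p.416] -/
theorem jprec_posDef (C : ChargeData N) {msq mu0sq : ℝ} (hm : 0 < msq) (hmu : 0 < mu0sq) :
    (jprec P k N C msq mu0sq).PosDef := by
  have hA := precA_posDef (P := P) (k := k) hmu
  have hS := precMat_posDef (P := P) (k := k) (chargeZero C) hm
  refine Matrix.posDef_iff_dotProduct_mulVec.mpr ⟨?_, fun z hz => ?_⟩
  · unfold jprec
    exact Matrix.IsHermitian.fromBlocks hA.1 (by simp) hS.1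
  · simp only [star_trivial]
    rw [dotProduct_jprec_mulVec]
    have hA' := (Matrix.posDef_iff_dotProduct_mulVec.mp hA).2
    have hS' := (Matrix.posDef_iff_dotProduct_mulVec.mp hS).2
    have hA0 : ∀ u : CrdA P k → ℝ, 0 ≤ u ⬝ᵥ (precA P k mu0sq *ᵥ u) := fun u => by
      by_cases hu : u = 0
      · simp [hu]
      · simpa using (hA' hu).le
    have hS0 : ∀ v : Crd P k N → ℝ, 0 ≤ v ⬝ᵥ (precMat (P := P) (k := k) (chargeZero C) msq *ᵥ v) := fun v => by
      by_cases hv : v = 0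
      · simp [hv]
      · simpa using (hS' hv).le
    by_cases hu : z ∘ Sum.inl = 0
    · have hv : z ∘ Sum.inr ≠ 0 := by
        intro hv; apply hz
        rw [← Sum.elim_comp_inl_inr z, hu, hv]
        funext i; cases i <;> rfl
      have := hS' hv
      simp only [star_trivial] at this
      linarith [hA0 (z ∘ Sum.inl)]
    · have := hA' hu
      simp only [star_trivial] at this
      linarith [hS0 (z ∘ Sum.inr)]

/-- **`ν⁰`-EXPECTATIONS ARE JOINT GAUSSIAN EXPECTATIONS**: `⟨G⟩_{ν⁰} = gexp jprec 0 (G ∘ jc⁻¹)` for every `G`.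
[cite: Balaban1983Higgs3, (1.19)–(1.21) p.416] -/
theorem expectJ_eq_gexp (C : ChargeData N) (msq mu0sq : ℝ) (G : Cfg P k N → ℝ) :
    expectJ (P := P) (k := k) C msq mu0sq G = gexp (jprec P k N C msq mu0sq) 0 fun z => G (jcInv z) := by
  have key : ∀ H : Cfg P k N → ℝ, ∫ Φ, H Φ ∂(freeMeasure P k N (chargeZero C) msq mu0sq)
      = ∫ z : JCrd P k N → ℝ, H (jcInv z) * weight (jprec P k N C msq mu0sq) z := by
    intro H
    rw [integral_freeMeasure, integral_comp_jc]
    refine integral_congr_ae (ae_of_all _ fun z => ?_)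
    dsimp only
    rw [← jc_jcInv (P := P) (k := k) (N := N) z, weight_jprec, jcInv_jc, mul_comm]
  rw [expectJ, measureReal_univ_eq_integral, key G, key (fun _ => 1), gexp_zero_source]
  simp only [one_mul]

end JPrec

/-! ## §3 The LEGS of the vertices as linear functionals of the joint coordinates: `φ_a(x)`, `A_b`, `(∂^εφ)_a(b)`,
`(q^jφ(x))_a` -/

/-- The scalar leg `φ_a(x)`. [cite: Balaban1983Higgs3, (1.6)–(1.10) p.413] -/
def sLeg (x : HiggsLattice.Site P k) (a : Fin N) : JCrd P k N → ℝ := Sum.elim 0 (legV x a)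

/-- `(jcΦ)·sLeg x a = φ_a(x)`. [cite: Balaban1983Higgs3, (1.6)–(1.10) p.413] -/
theorem jc_dotProduct_sLeg (Φ : Cfg P k N) (x : HiggsLattice.Site P k) (a : Fin N) :
    jc Φ ⬝ᵥ sLeg x a = Φ.2 x a := by
  rw [jc, sLeg, sumElim_dotProduct_sumElim, dotProduct_zero, zero_add, dotProduct_legV]

/-- Read on the coordinate side: `(jc⁻¹z).φ_a(x) = z·sLeg x a`. [cite: Balaban1983Higgs3, (1.19) p.416] -/
theorem jcInv_snd_apply (z : JCrd P k N → ℝ) (x : HiggsLattice.Site P k) (a : Fin N) :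
    (jcInv z).2 x a = z ⬝ᵥ sLeg x a := by
  rw [← jc_dotProduct_sLeg (jcInv z), jc_jcInv]

/-- The DIFFERENCE leg `(∂^ηφ)_a(b) = η⁻¹(φ_a(b₊) − φ_a(b₋))` (the leg `D^η_{B̃}φ′` of (1.8) at `B̃ = 0`).
[cite: Balaban1983Higgs3, (1.8) p.413] -/
def dLeg (b : HiggsLattice.PBond P k) (a : Fin N) : JCrd P k N → ℝ := (P.mesh k)⁻¹ • (sLeg b.tgt a - sLeg b.src a)

/-- `(jcΦ)·dLeg b a = (∂^ηφ)(b)_a`. [cite: Balaban1983Higgs3, (1.8) p.413] -/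
theorem jc_dotProduct_dLeg (Φ : Cfg P k N) (b : HiggsLattice.PBond P k) (a : Fin N) :
    jc Φ ⬝ᵥ dLeg b a = sderiv Φ.2 b a := by
  rw [dLeg, dotProduct_smul, dotProduct_sub, jc_dotProduct_sLeg, jc_dotProduct_sLeg, sderiv, smul_eq_mul,
    PiLp.smul_apply, PiLp.sub_apply, smul_eq_mul]

/-- The matrix entries of an operator of `ℝ^N` in the standard basis: `T_{ac} = (T e_c)_a`. [folklore]
[cite: Balaban1983Higgs3, (1.8) p.413] -/
def opEntry (T : E N →L[ℝ] E N) (a c : Fin N) : ℝ := T (EuclideanSpace.single c (1 : ℝ)) a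

/-- `(Tv)_a = Σ_c T_{ac} v_c`. [folklore] [cite: Balaban1983Higgs3, (1.8) p.413] -/
theorem apply_eq_sum_opEntry (T : E N →L[ℝ] E N) (v : E N) (a : Fin N) :
    T v a = ∑ c, opEntry T a c * v c := by
  conv_lhs => rw [← (EuclideanSpace.basisFun (Fin N) ℝ).sum_repr v]
  rw [map_sum]
  simp only [map_smul, EuclideanSpace.basisFun_repr, EuclideanSpace.basisFun_apply, opEntry]
  rw [WithLp.ofLp_sum, Finset.sum_apply]
  exact sum_congr rfl fun c _ => by rw [WithLp.ofLp_smul, Pi.smul_apply, smul_eq_mul, mul_comm]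

/-- The `q`-LEG `(Tφ(x))_a = Σ_c T_{ac}φ_c(x)` (`T = q^j`, the legs `q^{n+n′}φ′(b₋)` of (1.8)/(1.10)).
[cite: Balaban1983Higgs3, (1.8)/(1.10) p.413] -/
def qLeg (T : E N →L[ℝ] E N) (x : HiggsLattice.Site P k) (a : Fin N) : JCrd P k N → ℝ :=
  ∑ c : Fin N, opEntry T a c • sLeg x c

/-- `(jcΦ)·qLeg T x a = (Tφ(x))_a`. [cite: Balaban1983Higgs3, (1.8)/(1.10) p.413] -/
theorem jc_dotProduct_qLeg (Φ : Cfg P k N) (T : E N →L[ℝ] E N) (x : HiggsLattice.Site P k) (a : Fin N) :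
    jc Φ ⬝ᵥ qLeg T x a = T (Φ.2 x) a := by
  rw [qLeg, dotProduct_sum, apply_eq_sum_opEntry]
  exact sum_congr rfl fun c _ => by rw [dotProduct_smul, jc_dotProduct_sLeg, smul_eq_mul]

/-- The inner product of `ℝ^N` in components: `⟪u, v⟫ = Σ_a u_a v_a`. [folklore] [cite: Balaban1983Higgs3, (1.8) p.413] -/
theorem inner_eq_sum_mul (u v : E N) : ⟪u, v⟫_ℝ = ∑ a, u a * v a := by
  rw [PiLp.inner_apply]
  exact sum_congr rfl fun a _ => by simp [mul_comm]

section ALeg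

variable [DecidableEq (HiggsLattice.PBond P k)]

/-- The vector leg `A_b`. [cite: Balaban1983Higgs3, (1.8)/(1.10) p.413] -/
def aLeg (b : HiggsLattice.PBond P k) : JCrd P k N → ℝ :=
  Sum.elim (fcA P k (Pi.single b (1 : ℝ))) (0 : Crd P k N → ℝ)

/-- `Σ_c A_c (δ_b)_c = A_b` in p34's coordinates. [cite: Balaban1982Higgs1, p.605] -/
theorem fcA_dotProduct_single (A : HiggsLattice.VecField P k) (b : HiggsLattice.PBond P k) :
    fcA P k A ⬝ᵥ fcA P k (Pi.single b (1 : ℝ)) = A b := by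
  rw [← sum_inner_eq_dotProduct ℝ,
    Finset.sum_eq_single b (fun y _ hy => by rw [Pi.single_eq_of_ne hy, inner_zero_right])
      (fun h => absurd (mem_univ b) h), Pi.single_eq_same]
  simp

/-- `(jcΦ)·aLeg b = A_b`. [cite: Balaban1983Higgs3, (1.8)/(1.10) p.413] -/
theorem jc_dotProduct_aLeg (Φ : Cfg P k N) (b : HiggsLattice.PBond P k) :
    jc Φ ⬝ᵥ (aLeg b : JCrd P k N → ℝ) = Φ.1 b := by
  rw [jc, aLeg, sumElim_dotProduct_sumElim, dotProduct_zero, add_zero, fcA_dotProduct_single]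

/-- `(jc⁻¹z).A_b = z·aLeg b`. [cite: Balaban1983Higgs3, (1.19) p.416] -/
theorem jcInv_fst_apply (z : JCrd P k N → ℝ) (b : HiggsLattice.PBond P k) :
    (jcInv z).1 b = z ⬝ᵥ (aLeg b : JCrd P k N → ℝ) := by
  rw [← jc_dotProduct_aLeg (jcInv z), jc_jcInv]

end ALeg

/-! ## §4 Print's vertices (1.6), (1.7), (1.8)_{j,0}, (1.10)_{j,0} at unit charge and the observable as POLYNOMIAL
CLUSTERS in the legs (BRICK 5's `clusterVar`) -/

section Clusters

variable [DecidableEq (HiggsLattice.PBond P k)]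

/-- **The inner colours** of the clusters: `(y,a,c)` = the quartic (1.6) at `y` with indices `a, c` (4 legs);
`(y,a)` = the mass vertex (1.7) (2 legs); `(i,b,a)` = (1.8)_{i+1,0} at the bond `b`, index `a` (legs `(∂φ)_a(b)`,
`(q^{i+1}φ(b₋))_a`, `A_b^{i+1}`: `i + 3` legs); `(i,b,a)'` = (1.10)_{i+1,0} (legs `φ_a(b₋)`, `(q^{i+1}φ(b₋))_a`, `A_b^{i+1}`);
`()` = the observable `φ_{a₀}(x₀)φ_{b₀}(x₀′)`. [cite: Balaban1983Higgs3, (1.6)–(1.10) p.413, p.414] -/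
abbrev VCol (P : HiggsLattice.Params) (k N nbar : ℕ) : Type :=
  (HiggsLattice.Site P k × Fin N × Fin N) ⊕ (HiggsLattice.Site P k × Fin N)
    ⊕ (Fin nbar × HiggsLattice.PBond P k × Fin N) ⊕ (Fin nbar × HiggsLattice.PBond P k × Fin N) ⊕ Unit

variable {nbar : ℕ}

/-- The number of legs of a colour. [cite: Balaban1983Higgs3, (1.6)–(1.10) p.413] -/
def vdeg : VCol P k N nbar → ℕ
  | Sum.inl _ => 4
  | Sum.inr (Sum.inl _) => 2
  | Sum.inr (Sum.inr (Sum.inl (i, _))) => (i : ℕ) + 3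
  | Sum.inr (Sum.inr (Sum.inr (Sum.inl (i, _)))) => (i : ℕ) + 3
  | Sum.inr (Sum.inr (Sum.inr (Sum.inr _))) => 2

/-- The legs of the colours (observable `φ_{a₀}(x₀)φ_{b₀}(x₀′)`). [cite: Balaban1983Higgs3, (1.6)–(1.10) p.413] -/
def vleg (C : ChargeData N) (a₀ b₀ : Fin N) (x₀ x₀' : HiggsLattice.Site P k) : VCol P k N nbar → ℕ → (JCrd P k N → ℝ)
  | Sum.inl (y, a, _), 0 => sLeg y a
  | Sum.inl (y, a, _), 1 => sLeg y a
  | Sum.inl (y, _, c), _ + 2 => sLeg y c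
  | Sum.inr (Sum.inl (y, a)), _ => sLeg y a
  | Sum.inr (Sum.inr (Sum.inl (_, b, a))), 0 => dLeg b a
  | Sum.inr (Sum.inr (Sum.inl (i, b, a))), 1 => qLeg (C.q ^ ((i : ℕ) + 1)) b.src a
  | Sum.inr (Sum.inr (Sum.inl (_, b, _))), _ + 2 => aLeg b
  | Sum.inr (Sum.inr (Sum.inr (Sum.inl (_, b, a)))), 0 => sLeg b.src a
  | Sum.inr (Sum.inr (Sum.inr (Sum.inl (i, b, a)))), 1 => qLeg (C.q ^ ((i : ℕ) + 1)) b.src a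
  | Sum.inr (Sum.inr (Sum.inr (Sum.inl (_, b, _)))), _ + 2 => aLeg b
  | Sum.inr (Sum.inr (Sum.inr (Sum.inr _))), 0 => sLeg x₀ a₀
  | Sum.inr (Sum.inr (Sum.inr (Sum.inr _))), _ + 1 => sLeg x₀' b₀

/-- The coefficients of the colours at UNIT charge: `−λη^d`, `−½δm²η^d`, `(−1)^{i+1}η^{i}/(i+1)!·η^d`, `η^{i−1}/(i+1)!·η^d`, `1`.
[cite: Balaban1983Higgs3, (1.6)–(1.10) p.413] -/
def vcoef (P : HiggsLattice.Params) (k : ℕ) (lam dm2 : ℝ) : VCol P k N nbar → ℝ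
  | Sum.inl _ => -(lam * P.mesh k ^ P.d)
  | Sum.inr (Sum.inl _) => -(1 / 2 : ℝ) * (P.mesh k ^ P.d * dm2)
  | Sum.inr (Sum.inr (Sum.inl (i, _))) =>
      (-1 : ℝ) ^ ((i : ℕ) + 1) * P.mesh k ^ (i : ℕ) / (((i : ℕ) + 1).factorial : ℝ) * P.mesh k ^ P.d
  | Sum.inr (Sum.inr (Sum.inr (Sum.inl (i, _)))) =>
      P.mesh k ^ (((i : ℕ) : ℤ) - 1) / (((i : ℕ) + 1).factorial : ℝ) * P.mesh k ^ P.d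
  | Sum.inr (Sum.inr (Sum.inr (Sum.inr _))) => 1

/-- The colour set of a vertex TYPE (empty for the R-colour, which is not polynomial). [cite: Balaban1983Higgs3, (1.6)–(1.10) p.413] -/
def typeCols (P : HiggsLattice.Params) (k N nbar : ℕ) : VType nbar → Finset (VCol P k N nbar)
  | Sum.inl i =>
      ![(univ : Finset (HiggsLattice.Site P k × Fin N × Fin N)).map ⟨Sum.inl, Sum.inl_injective⟩,
        (univ : Finset (HiggsLattice.Site P k × Fin N)).map
          ⟨fun p => Sum.inr (Sum.inl p), fun _ _ h => by simpa using h⟩,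
        ∅] i
  | Sum.inr (Sum.inl i) =>
      (univ : Finset (HiggsLattice.PBond P k × Fin N)).map
        ⟨fun p => Sum.inr (Sum.inr (Sum.inl (i, p))), fun _ _ h => by simpa using h⟩
  | Sum.inr (Sum.inr i) =>
      (univ : Finset (HiggsLattice.PBond P k × Fin N)).map
        ⟨fun p => Sum.inr (Sum.inr (Sum.inr (Sum.inl (i, p)))), fun _ _ h => by simpa using h⟩

/-- The cluster colour sets of a colouring `z` of the `n` vertices: the observable cluster `none` and the vertex
clusters `some j` of type `z j`. [cite: Balaban1983Higgs3, (1.21) p.416] -/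
def vK {n : ℕ} (z : Fin n → VType nbar) : Option (Fin n) → Finset (VCol P k N nbar)
  | none => {Sum.inr (Sum.inr (Sum.inr (Sum.inr ())))}
  | some j => typeCols P k N nbar (z j)

variable (C : ChargeData N) (lam dm2 : ℝ) (a₀ b₀ : Fin N) (x₀ x₀' : HiggsLattice.Site P k)

/-- **The observable cluster is `φ_{a₀}(x₀)φ_{b₀}(x₀′)`.** [cite: Balaban1983Higgs3, (1.19) p.416] -/
theorem clusterVar_none {n : ℕ} (z : Fin n → VType nbar) (w : JCrd P k N → ℝ) :
    clusterVar (vK (P := P) (k := k) (N := N) z) (fun _ => vcoef P k lam dm2) vdeg (vleg C a₀ b₀ x₀ x₀') none w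
      = (jcInv w).2 x₀ a₀ * (jcInv w).2 x₀' b₀ := by
  rw [clusterVar, vK, sum_singleton, vcoef, one_mul, legProd, jcInv_snd_apply, jcInv_snd_apply]
  show ∏ l : Fin 2, w ⬝ᵥ vleg C a₀ b₀ x₀ x₀' (Sum.inr (Sum.inr (Sum.inr (Sum.inr ())))) l = _
  rw [Fin.prod_univ_two]
  rfl

omit [DecidableEq (HiggsLattice.PBond P k)] in
/-- The leg product of a colour with `m + 3` legs whose legs from the third on coincide: `v₀·v₁·u^{m+1}`. [folklore]
[cite: Balaban1983Higgs3, (1.8)/(1.10) p.413] -/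
private theorem legProd_three (c : VCol P k N nbar) (w : JCrd P k N → ℝ) (lv : VCol P k N nbar → ℕ → (JCrd P k N → ℝ))
    {m : ℕ} (hdeg : vdeg c = m + 3) (u : JCrd P k N → ℝ) (hu : ∀ l, lv c (l + 2) = u) :
    legProd vdeg lv c w = (w ⬝ᵥ lv c 0) * (w ⬝ᵥ lv c 1) * (w ⬝ᵥ u) ^ (m + 1) := by
  rw [legProd, Fin.prod_univ_eq_prod_range (fun l => w ⬝ᵥ lv c l), hdeg, prod_range_succ', prod_range_succ']
  simp only [zero_add, hu, prod_const, card_range]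
  ring

/-- **The (1.8)_{i+1,0} cluster at unit charge**: `Σ_{b,a} coef·(∂φ)_a(b)(q^{i+1}φ(b₋))_a A_b^{i+1} = vertex18 …`.
[cite: Balaban1983Higgs3, (1.8) p.413] -/
theorem clusterVar_v18 {n : ℕ} (z : Fin n → VType nbar) (j : Fin n) (i : Fin nbar) (hz : z j = Sum.inr (Sum.inl i))
    (w : JCrd P k N → ℝ) :
    clusterVar (vK (P := P) (k := k) (N := N) z) (fun _ => vcoef P k lam dm2) vdeg (vleg C a₀ b₀ x₀ x₀') (some j) w
      = vtx (chargeOne C) lam dm2 nbar (Sum.inr (Sum.inl i)) (jcInv w) := by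
  rw [clusterVar, vK, hz, typeCols, sum_map, vtx_inr_inl]
  unfold vertex18
  simp only [Function.Embedding.coeFn_mk, chargeOne_e, chargeOne_q, one_pow, one_mul, add_zero, Nat.factorial_zero,
    Nat.cast_one, mul_one, pow_zero]
  rw [mul_sum, Fintype.sum_prod_type]
  refine sum_congr rfl fun b _ => ?_
  -- the leg bracket in components
  have hleg : leg18 (chargeOne C) 0 (jcInv w).2 (C.q ^ ((i : ℕ) + 1)) b
      = ∑ a : Fin N, (w ⬝ᵥ dLeg b a) * (w ⬝ᵥ qLeg (C.q ^ ((i : ℕ) + 1)) b.src a) := by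
    unfold leg18
    rw [covDeriv_zero, inner_eq_sum_mul]
    refine sum_congr rfl fun a _ => ?_
    rw [← jc_jcInv (P := P) (k := k) (N := N) w, jc_dotProduct_dLeg, jc_dotProduct_qLeg, jc_jcInv]
  rw [hleg, mul_sum, sum_mul, mul_sum]
  refine sum_congr rfl fun a _ => ?_
  rw [legProd_three (Sum.inr (Sum.inr (Sum.inl (i, b, a)))) w (vleg C a₀ b₀ x₀ x₀') (m := (i : ℕ)) rfl (aLeg b)
    (fun l => rfl)]
  simp only [vcoef, vleg]
  rw [← jcInv_fst_apply]
  have hz' : P.mesh k ^ ((((i : ℕ) + 1 : ℕ) : ℤ) + ((0 : ℕ) : ℤ) - 1) = P.mesh k ^ (i : ℕ) := by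
    rw [show ((((i : ℕ) + 1 : ℕ) : ℤ) + ((0 : ℕ) : ℤ) - 1 : ℤ) = ((i : ℕ) : ℤ) by push_cast; ring, zpow_natCast]
  rw [hz']
  ring

omit [DecidableEq (HiggsLattice.PBond P k)] in
/-- The leg product of a colour with `2` legs. [folklore] [cite: Balaban1983Higgs3, (1.7) p.413] -/
private theorem legProd_two (c : VCol P k N nbar) (w : JCrd P k N → ℝ) (lv : VCol P k N nbar → ℕ → (JCrd P k N → ℝ))
    (hdeg : vdeg c = 2) : legProd vdeg lv c w = (w ⬝ᵥ lv c 0) * (w ⬝ᵥ lv c 1) := by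
  rw [legProd, Fin.prod_univ_eq_prod_range (fun l => w ⬝ᵥ lv c l), hdeg]
  simp [prod_range_succ]

omit [DecidableEq (HiggsLattice.PBond P k)] in
/-- The leg product of a colour with `4` legs. [folklore] [cite: Balaban1983Higgs3, (1.6) p.413] -/
private theorem legProd_four (c : VCol P k N nbar) (w : JCrd P k N → ℝ) (lv : VCol P k N nbar → ℕ → (JCrd P k N → ℝ))
    (hdeg : vdeg c = 4) :
    legProd vdeg lv c w = (w ⬝ᵥ lv c 0) * (w ⬝ᵥ lv c 1) * (w ⬝ᵥ lv c 2) * (w ⬝ᵥ lv c 3) := by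
  rw [legProd, Fin.prod_univ_eq_prod_range (fun l => w ⬝ᵥ lv c l), hdeg]
  simp [prod_range_succ, mul_assoc]

/-- **The (1.10)_{i+1,0} cluster at unit charge**: `Σ_{b,a} coef·φ_a(b₋)(q^{i+1}φ(b₋))_a A_b^{i+1} = vertex110 …`.
[cite: Balaban1983Higgs3, (1.10) p.413] -/
theorem clusterVar_v110 {n : ℕ} (z : Fin n → VType nbar) (j : Fin n) (i : Fin nbar) (hz : z j = Sum.inr (Sum.inr i))
    (w : JCrd P k N → ℝ) :
    clusterVar (vK (P := P) (k := k) (N := N) z) (fun _ => vcoef P k lam dm2) vdeg (vleg C a₀ b₀ x₀ x₀') (some j) w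
      = vtx (chargeOne C) lam dm2 nbar (Sum.inr (Sum.inr i)) (jcInv w) := by
  rw [clusterVar, vK, hz, typeCols, sum_map, vtx_inr_inr]
  unfold vertex110
  simp only [Function.Embedding.coeFn_mk, chargeOne_e, chargeOne_q, one_pow, one_mul, add_zero, Nat.factorial_zero,
    Nat.cast_one, mul_one, pow_zero]
  rw [mul_sum, Fintype.sum_prod_type]
  refine sum_congr rfl fun b _ => ?_
  have hleg : leg110 (jcInv w).2 (C.q ^ ((i : ℕ) + 1)) b
      = ∑ a : Fin N, (w ⬝ᵥ sLeg b.src a) * (w ⬝ᵥ qLeg (C.q ^ ((i : ℕ) + 1)) b.src a) := by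
    unfold leg110
    rw [inner_eq_sum_mul]
    refine sum_congr rfl fun a _ => ?_
    rw [← jc_jcInv (P := P) (k := k) (N := N) w, jc_dotProduct_sLeg, jc_dotProduct_qLeg, jc_jcInv]
  rw [hleg, mul_sum, sum_mul, mul_sum]
  refine sum_congr rfl fun a _ => ?_
  rw [legProd_three (Sum.inr (Sum.inr (Sum.inr (Sum.inl (i, b, a))))) w (vleg C a₀ b₀ x₀ x₀') (m := (i : ℕ)) rfl
    (aLeg b) (fun l => rfl)]
  simp only [vcoef, vleg]
  rw [← jcInv_fst_apply]
  have hz' : P.mesh k ^ ((((i : ℕ) + 1 : ℕ) : ℤ) + ((0 : ℕ) : ℤ) - 2) = P.mesh k ^ (((i : ℕ) : ℤ) - 1) := by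
    congr 1; push_cast; ring
  rw [hz']
  ring

/-- **The (1.6) cluster**: `Σ_{y,a,c} (−λη^d)φ_a(y)²φ_c(y)² = −λΣ_y η^d|φ(y)|⁴ = vertex16`. [cite: Balaban1983Higgs3, (1.6) p.413] -/
theorem clusterVar_v16 {n : ℕ} (z : Fin n → VType nbar) (j : Fin n) (hz : z j = Sum.inl 0) (w : JCrd P k N → ℝ) :
    clusterVar (vK (P := P) (k := k) (N := N) z) (fun _ => vcoef P k lam dm2) vdeg (vleg C a₀ b₀ x₀ x₀') (some j) w
      = vtx (chargeOne C) lam dm2 nbar (Sum.inl 0) (jcInv w) := by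
  rw [clusterVar, vK, hz, typeCols, Matrix.cons_val_zero, sum_map, vtx_inl_zero]
  unfold vertex16
  rw [mul_sum, ← sum_neg_distrib, Fintype.sum_prod_type]
  refine sum_congr rfl fun y _ => ?_
  rw [Fintype.sum_prod_type]
  have h4 : ∀ a c : Fin N, vcoef P k lam dm2 (Sum.inl (y, a, c) : VCol P k N nbar)
      * legProd vdeg (vleg C a₀ b₀ x₀ x₀') (Sum.inl (y, a, c) : VCol P k N nbar) w
      = -(lam * P.mesh k ^ P.d) * ((jcInv w).2 y a ^ 2 * (jcInv w).2 y c ^ 2) := by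
    intro a c
    rw [legProd_four _ _ _ rfl, jcInv_snd_apply, jcInv_snd_apply]
    simp only [vcoef, vleg]
    ring
  have hn : ‖(jcInv w).2 y‖ ^ 4 = ∑ a, ∑ c, (jcInv w).2 y a ^ 2 * (jcInv w).2 y c ^ 2 := by
    rw [show (4 : ℕ) = 2 * 2 from rfl, pow_mul, norm_sq_eq_sum, sq, Finset.sum_mul_sum]
  simp only [Function.Embedding.coeFn_mk, h4]
  rw [hn, mul_sum, mul_sum, ← sum_neg_distrib]
  refine sum_congr rfl fun a _ => ?_
  rw [mul_sum, mul_sum, ← sum_neg_distrib]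
  refine sum_congr rfl fun c _ => ?_
  ring

/-- **The (1.7) cluster**: `Σ_{y,a} (−½δm²η^d)φ_a(y)² = −½Σ_y η^dδm²|φ(y)|² = vertex17`. [cite: Balaban1983Higgs3, (1.7) p.413] -/
theorem clusterVar_v17 {n : ℕ} (z : Fin n → VType nbar) (j : Fin n) (hz : z j = Sum.inl 1) (w : JCrd P k N → ℝ) :
    clusterVar (vK (P := P) (k := k) (N := N) z) (fun _ => vcoef P k lam dm2) vdeg (vleg C a₀ b₀ x₀ x₀') (some j) w
      = vtx (chargeOne C) lam dm2 nbar (Sum.inl 1) (jcInv w) := by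
  rw [clusterVar, vK, hz, typeCols, Matrix.cons_val_one, Matrix.cons_val_zero, sum_map, vtx_inl_one]
  unfold vertex17
  rw [mul_sum, Fintype.sum_prod_type]
  refine sum_congr rfl fun y _ => ?_
  have h2 : ∀ a : Fin N, vcoef P k lam dm2 (Sum.inr (Sum.inl (y, a)) : VCol P k N nbar)
      * legProd vdeg (vleg C a₀ b₀ x₀ x₀') (Sum.inr (Sum.inl (y, a)) : VCol P k N nbar) w
      = -(1 / 2 : ℝ) * (P.mesh k ^ P.d * dm2) * (jcInv w).2 y a ^ 2 := by
    intro a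
    rw [legProd_two _ _ _ rfl, jcInv_snd_apply]
    simp only [vcoef, vleg]
    ring
  simp only [Function.Embedding.coeFn_mk, h2]
  rw [one_pow, mul_one, norm_sq_eq_sum, mul_sum, mul_sum]
  refine sum_congr rfl fun a _ => ?_
  ring

/-- **Every GENUINE vertex type at unit charge is its polynomial cluster, read through the joint coordinates.**
[cite: Balaban1983Higgs3, (1.6)–(1.10) p.413] -/
theorem clusterVar_some {n : ℕ} (z : Fin n → VType nbar) (j : Fin n) (hz : Genuine nbar (z j)) (w : JCrd P k N → ℝ) :
    clusterVar (vK (P := P) (k := k) (N := N) z) (fun _ => vcoef P k lam dm2) vdeg (vleg C a₀ b₀ x₀ x₀') (some j) w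
      = vtx (chargeOne C) lam dm2 nbar (z j) (jcInv w) := by
  rcases h : z j with i | i | i
  · fin_cases i
    · exact clusterVar_v16 C lam dm2 a₀ b₀ x₀ x₀' z j h w
    · exact clusterVar_v17 C lam dm2 a₀ b₀ x₀ x₀' z j h w
    · rw [h] at hz; exact absurd hz (not_genuine_inl_two nbar)
  · rw [← h]; exact (clusterVar_v18 C lam dm2 a₀ b₀ x₀ x₀' z j i h w).trans (by rw [h])
  · rw [← h]; exact (clusterVar_v110 C lam dm2 a₀ b₀ x₀ x₀' z j i h w).trans (by rw [h])

omit [DecidableEq (HiggsLattice.PBond P k)] in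
/-- `Π_{x ∈ K} f x = [f none]_{none ∈ K} · Π_{j present in K} f (some j)`. [folklore] [cite: Mastropietro2008, §2.3 (2.38)] -/
theorem prod_option_split {R : Type*} [CommMonoid R] {n : ℕ} (f : Option (Fin n) → R) (K : Finset (Option (Fin n))) :
    ∏ x ∈ K, f x = (if none ∈ K then f none else 1) * ∏ j ∈ present K, f (some j) := by
  rw [prod_present_eq, ← prod_filter_mul_prod_filter_not K (fun x => x = none)]
  congr 1
  · rw [prod_filter, prod_ite_eq']
  · rw [prod_filter]
    refine prod_congr rfl fun x _ => ?_
    cases x <;> simp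

/-- **The product of the clusters over a vertex family, read on the field side**:
`Π_{x∈K} X_x(w) = [φ_{a₀}(x₀)φ_{b₀}(x₀′)]_{pin ∈ K} · Π_{j present} X_{z_j}(1)(jc⁻¹w)`. [cite: Balaban1983Higgs3, (1.21) p.416] -/
theorem prod_clusterVar {n : ℕ} (z : Fin n → VType nbar) (hz : ∀ j, Genuine nbar (z j)) (K : Finset (Option (Fin n)))
    (w : JCrd P k N → ℝ) :
    ∏ x ∈ K, clusterVar (vK (P := P) (k := k) (N := N) z) (fun _ => vcoef P k lam dm2) vdeg (vleg C a₀ b₀ x₀ x₀') x w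
      = (if none ∈ K then (jcInv w).2 x₀ a₀ * (jcInv w).2 x₀' b₀ else 1)
          * ∏ j ∈ present K, vtx (chargeOne C) lam dm2 nbar (z j) (jcInv w) := by
  rw [prod_option_split, clusterVar_none]
  congr 1
  exact prod_congr rfl fun j _ => clusterVar_some C lam dm2 a₀ b₀ x₀ x₀' z j (hz j) w

/-- **THE COLOUR MOMENTS OF FILE 2 ARE THE CLUSTER MOMENTS OF BRICK 5** for the joint Gaussian: for a genuine colouring `z`,
`colourMoment ν⁰ (φφ) X(1) ν⁰(Ω) z K = jmoment jprec (vK z) vcoef vdeg vleg K`. [cite: Balaban1983Higgs3, (1.21) p.416] -/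
theorem colourMoment_eq_jmoment (msq mu0sq : ℝ) {n : ℕ} (z : Fin n → VType nbar) (hz : ∀ j, Genuine nbar (z j))
    (K : Finset (Option (Fin n))) :
    colourMoment (freeMeasure P k N (chargeZero C) msq mu0sq) (fun Φ : Cfg P k N => Φ.2 x₀ a₀ * Φ.2 x₀' b₀)
        (vtx (chargeOne C) lam dm2 nbar) ((freeMeasure P k N (chargeZero C) msq mu0sq).real Set.univ) z K
      = jmoment (jprec P k N C msq mu0sq) (vK (P := P) (k := k) (N := N) z) (fun _ => vcoef P k lam dm2) vdeg
          (vleg C a₀ b₀ x₀ x₀') K := by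
  have h := expectJ_eq_gexp (P := P) (k := k) C msq mu0sq
    (fun Φ => (if none ∈ K then Φ.2 x₀ a₀ * Φ.2 x₀' b₀ else 1) * ∏ j ∈ present K, vtx (chargeOne C) lam dm2 nbar (z j) Φ)
  unfold expectJ at h
  unfold colourMoment
  rw [h, jmoment]
  congr 1
  funext w
  exact (prod_clusterVar C lam dm2 a₀ b₀ x₀ x₀' z hz K w).symm

end Clusters

/-! ## §5 THE HEADLINE: the charge-free coefficients `U_z` of (1.19) are sums over CONNECTED GRAPHS with BOTH propagators -/

section Headline

variable [DecidableEq (HiggsLattice.PBond P k)]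

/-- The vertex family of FILE 2 is all of `Option (Fin n)`. [cite: Mastropietro2008, §2.3 (2.38)] -/
theorem vfamily_eq_univ (n : ℕ) : vfamily n = (univ : Finset (Option (Fin n))) := by
  ext x
  simp only [mem_univ, iff_true]
  cases x with
  | none => exact mem_insert_self _ _
  | some j => exact some_mem_vfamily j

/-- **«THE PROPAGATORS ARE `C^ε_0` FOR THE SCALAR FIELD AND `C^ε` FOR THE VECTOR FIELD»** — the charge-free coefficient
`U_z = X_z(e := 1)` of a GENUINE colouring `z` of the `n` total vertices of (1.19) (FILE 2's `coefX (chargeOne C)`) is the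
sum, over the inner colourings `s` of the clusters (positions, internal indices of print's (1.6), (1.7), (1.8)_{j,0},
(1.10)_{j,0}) and over the CONNECTED Wick pairings `g` of their legs, of `Π coef · Π_{{l,l′}∈g} ⟨jprec⁻¹ v_l, v_{l′}⟩` — the
legs being `φ_a(x)`, `(∂^εφ)_a(b)`, `(q^jφ(b₋))_a` (scalar lines, propagator `C^ε_0`, §6) and `A_b` (vector lines,
propagator `C^ε`, §6), mixed pairs vanishing. [cite: Balaban1983Higgs3, (1.21) p.416, p.414] -/
theorem coefX_chargeOne_eq_sum_connected (C : ChargeData N) {msq mu0sq : ℝ} (hm : 0 < msq) (hmu : 0 < mu0sq)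
    (lam dm2 : ℝ) (a₀ b₀ : Fin N) (x₀ x₀' : HiggsLattice.Site P k) (nbar : ℕ) {n : ℕ} {z : Fin n → VType nbar}
    (hz : ∀ j, Genuine nbar (z j)) :
    coefX (chargeOne C) lam msq mu0sq dm2 (fun Φ : Cfg P k N => Φ.2 x₀ a₀ * Φ.2 x₀' b₀) nbar z
      = ∑ s ∈ Fintype.piFinset (vK (P := P) (k := k) (N := N) z), (∏ j, vcoef P k lam dm2 (s j)) *
          ∑ g ∈ (diags (Sigma.fst : Leg vdeg s → Option (Fin n)) ((univ : Finset (Option (Fin n))).map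
              Function.Embedding.some)).filter
              (IsConn (Sigma.fst : Leg vdeg s → Option (Fin n)) ((univ : Finset (Option (Fin n))).map
                Function.Embedding.some)),
            ∏ B ∈ g.2, pairW (jprec P k N C msq mu0sq) (legVec vdeg (vleg C a₀ b₀ x₀ x₀') s) B := by
  have h1 : coefX (chargeOne C) lam msq mu0sq dm2 (fun Φ : Cfg P k N => Φ.2 x₀ a₀ * Φ.2 x₀' b₀) nbar z
      = ursellOf (jmoment (jprec P k N C msq mu0sq) (vK (P := P) (k := k) (N := N) z) (fun _ => vcoef P k lam dm2) vdeg
          (vleg C a₀ b₀ x₀ x₀')) univ := by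
    rw [← vfamily_eq_univ]
    show ursellOf (colourMoment (freeMeasure P k N (chargeZero C) msq mu0sq) (fun Φ : Cfg P k N => Φ.2 x₀ a₀ * Φ.2 x₀' b₀)
        (vtx (chargeOne C) lam dm2 nbar) ((freeMeasure P k N (chargeZero C) msq mu0sq).real Set.univ) z) (vfamily n) = _
    congr 1
    funext K
    exact colourMoment_eq_jmoment C lam dm2 a₀ b₀ x₀ x₀' msq mu0sq z hz K
  rw [h1, ursellOf_jmoment_univ (jprec_posDef C hm hmu) (fun _ => (Sum.inr (Sum.inr (Sum.inr (Sum.inr ()))) : VCol P k N nbar))]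

/-- **The model instance** (`k = 0`, the data of (1.19)): the charge-free coefficients `U_z` of FILE 2's
`iteratedDerivWithin_totalFamily_zero_eq` / `twoPoint_charge_order_expansion` are the connected two-propagator graph sums.
[cite: Balaban1983Higgs3, (1.21) p.416] -/
theorem coefU_model_eq_sum_connected {D : B1Sect1Statements.ModelData} {P : HiggsLattice.Params}
    [DecidableEq (HiggsLattice.PBond P 0)] (hm : 0 < D.msq) (hmu : 0 < D.mu0sq) (a b : Fin D.N)
    (x x' : HiggsLattice.Site P 0) (nbar : ℕ) {n : ℕ} {z : Fin n → VType nbar} (hz : ∀ j, Genuine nbar (z j)) :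
    coefX (chargeOne D.C) D.lam D.msq D.mu0sq (D.δmsq P.ε D.C.e D.lam) (fun Φ : Cfg P 0 D.N => Φ.2 x a * Φ.2 x' b) nbar z
      = ∑ s ∈ Fintype.piFinset (vK (P := P) (k := 0) (N := D.N) z), (∏ j, vcoef P 0 D.lam (D.δmsq P.ε D.C.e D.lam) (s j)) *
          ∑ g ∈ (diags (Sigma.fst : Leg vdeg s → Option (Fin n)) ((univ : Finset (Option (Fin n))).map
              Function.Embedding.some)).filter
              (IsConn (Sigma.fst : Leg vdeg s → Option (Fin n)) ((univ : Finset (Option (Fin n))).map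
                Function.Embedding.some)),
            ∏ B ∈ g.2, pairW (jprec P 0 D.N D.C D.msq D.mu0sq) (legVec vdeg (vleg D.C a b x x') s) B :=
  coefX_chargeOne_eq_sum_connected D.C hm hmu D.lam _ a b x x' nbar hz

end Headline

/-! ## §6 The propagators of the legs: `C^ε_0` (scalar–scalar), `C^ε` (vector–vector), `0` (mixed) -/

section Propagators

variable [DecidableEq (HiggsLattice.PBond P k)]

/-- **The joint covariance is block-diagonal**: `jprec⁻¹ = precA⁻¹ ⊕ precMat⁻¹`. [cite: Balaban1983Higgs3, (1.21) p.416] -/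
theorem jprec_inv (C : ChargeData N) {msq mu0sq : ℝ} (hm : 0 < msq) (hmu : 0 < mu0sq) :
    (jprec P k N C msq mu0sq)⁻¹ = Matrix.fromBlocks (precA P k mu0sq)⁻¹ 0 0 (precMat (P := P) (k := k) (chargeZero C) msq)⁻¹ := by
  have hA : IsUnit (precA P k mu0sq).det := isUnit_iff_ne_zero.2 (precA_posDef (P := P) (k := k) hmu).det_pos.ne'
  have hS : IsUnit (precMat (P := P) (k := k) (chargeZero C) msq).det :=
    isUnit_iff_ne_zero.2 (precMat_posDef (P := P) (k := k) (chargeZero C) hm).det_pos.ne'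
  apply Matrix.inv_eq_right_inv
  rw [jprec, fromBlocks_multiply, mul_nonsing_inv _ hA, mul_nonsing_inv _ hS]
  simp [fromBlocks_one]

/-- **The vector propagator** `C^ε(b, b′) := ⟨A_b A_{b′}⟩` of the free vector Gaussian `exp(−½⟨A,(−Δ^ε+μ₀²)A⟩)dA`, as the
covariance `(precA⁻¹)` of the bond coordinates. [cite: Balaban1983Higgs3, (1.21) p.416] -/
def propA (P : HiggsLattice.Params) (k : ℕ) [DecidableEq (HiggsLattice.PBond P k)] (mu0sq : ℝ)
    (b b' : HiggsLattice.PBond P k) : ℝ :=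
  ((precA P k mu0sq)⁻¹ *ᵥ fcA P k (Pi.single b (1 : ℝ))) ⬝ᵥ fcA P k (Pi.single b' (1 : ℝ))

/-- **Scalar–scalar pairs carry `C^ε_0`**: `⟨jprec⁻¹ sLeg y a, sLeg y′ a′⟩ = C₀(y,a;y′,a′)` (gen 71's `prop0` of the free scalar
Gaussian at `e = 0`). [cite: Balaban1983Higgs3, (1.21) p.416] -/
theorem inv_sLeg_sLeg (C : ChargeData N) {msq mu0sq : ℝ} (hm : 0 < msq) (hmu : 0 < mu0sq)
    (y : HiggsLattice.Site P k) (a : Fin N) (y' : HiggsLattice.Site P k) (a' : Fin N) :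
    ((jprec P k N C msq mu0sq)⁻¹ *ᵥ sLeg y a) ⬝ᵥ (sLeg y' a' : JCrd P k N → ℝ)
      = prop0 P k N (chargeZero C) msq mu0sq y a y' a' := by
  rw [jprec_inv C hm hmu, sLeg, sLeg, fromBlocks_mulVec, prop0_eq_inv (chargeZero C) rfl hm hmu]
  simp [sumElim_dotProduct_sumElim]

/-- **Vector–vector pairs carry `C^ε`**: `⟨jprec⁻¹ aLeg b, aLeg b′⟩ = C^ε(b,b′)`. [cite: Balaban1983Higgs3, (1.21) p.416] -/
theorem inv_aLeg_aLeg (C : ChargeData N) {msq mu0sq : ℝ} (hm : 0 < msq) (hmu : 0 < mu0sq) (b b' : HiggsLattice.PBond P k) :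
    ((jprec P k N C msq mu0sq)⁻¹ *ᵥ aLeg b) ⬝ᵥ (aLeg b' : JCrd P k N → ℝ) = propA P k mu0sq b b' := by
  rw [jprec_inv C hm hmu, aLeg, aLeg, fromBlocks_mulVec, propA]
  simp [sumElim_dotProduct_sumElim]

/-- **Mixed pairs vanish** (the two fields are independent at `e = 0`). [cite: Balaban1983Higgs3, (1.21) p.416] -/
theorem inv_sLeg_aLeg (C : ChargeData N) {msq mu0sq : ℝ} (hm : 0 < msq) (hmu : 0 < mu0sq)
    (y : HiggsLattice.Site P k) (a : Fin N) (b : HiggsLattice.PBond P k) :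
    ((jprec P k N C msq mu0sq)⁻¹ *ᵥ sLeg y a) ⬝ᵥ (aLeg b : JCrd P k N → ℝ) = 0
    ∧ ((jprec P k N C msq mu0sq)⁻¹ *ᵥ aLeg b) ⬝ᵥ (sLeg y a : JCrd P k N → ℝ) = 0 := by
  rw [jprec_inv C hm hmu, sLeg, aLeg, fromBlocks_mulVec, fromBlocks_mulVec]
  simp [sumElim_dotProduct_sumElim]

/-- **The vector propagator IS the `ν⁰` two-point function of the bond variables**: `C^ε(b,b′) = ⟨A_bA_{b′}⟩_{ν⁰}`.
[cite: Balaban1983Higgs3, (1.21) p.416] -/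
theorem propA_eq_expectJ (C : ChargeData N) {msq mu0sq : ℝ} (hm : 0 < msq) (hmu : 0 < mu0sq) (b b' : HiggsLattice.PBond P k) :
    propA P k mu0sq b b' = expectJ (P := P) (k := k) C msq mu0sq fun Φ => Φ.1 b * Φ.1 b' := by
  rw [expectJ_eq_gexp, ← inv_aLeg_aLeg C hm hmu]
  have h : (fun w : JCrd P k N → ℝ => (jcInv w).1 b * (jcInv w).1 b')
      = fun w => (w ⬝ᵥ (aLeg b : JCrd P k N → ℝ)) * (w ⬝ᵥ (aLeg b' : JCrd P k N → ℝ)) := by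
    funext w; rw [jcInv_fst_apply, jcInv_fst_apply]
  rw [h, gexp_two_legs (jprec_posDef C hm hmu)]

/-- **The scalar propagator is the `ν⁰` two-point function of the field components**: `C₀(y,a;y′,a′) = ⟨φ_a(y)φ_{a′}(y′)⟩_{ν⁰}`
(the same number as gen 71's `prop0`, whose Green's-function equation `(−Δ^ε_0+m²)C₀ = ε^{−d}δ` is `freeOp_propCol`).
[cite: Balaban1983Higgs3, (1.21) p.416] -/
theorem prop0_eq_expectJ (C : ChargeData N) {msq mu0sq : ℝ} (hm : 0 < msq) (hmu : 0 < mu0sq)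
    (y : HiggsLattice.Site P k) (a : Fin N) (y' : HiggsLattice.Site P k) (a' : Fin N) :
    prop0 P k N (chargeZero C) msq mu0sq y a y' a' = expectJ (P := P) (k := k) C msq mu0sq fun Φ => Φ.2 y a * Φ.2 y' a' := by
  rw [expectJ_eq_gexp, ← inv_sLeg_sLeg C hm hmu]
  have h : (fun w : JCrd P k N → ℝ => (jcInv w).2 y a * (jcInv w).2 y' a')
      = fun w => (w ⬝ᵥ (sLeg y a : JCrd P k N → ℝ)) * (w ⬝ᵥ (sLeg y' a' : JCrd P k N → ℝ)) := by
    funext w; rw [jcInv_snd_apply, jcInv_snd_apply]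
  rw [h, gexp_two_legs (jprec_posDef C hm hmu)]

omit [DecidableEq (HiggsLattice.PBond P k)] in
/-- The covariance pairing is bilinear in the legs, so the pairings of the composite legs `(∂^εφ)_a(b) = ε⁻¹(φ_a(b₊) − φ_a(b₋))`
and `(q^jφ(x))_a = Σ_c (q^j)_{ac}φ_c(x)` are the corresponding combinations of `C^ε_0` entries.
[cite: Balaban1983Higgs3, (1.21) p.416] -/
theorem inv_dotProduct_bilinear (M : Matrix (JCrd P k N) (JCrd P k N) ℝ) (u u' v : JCrd P k N → ℝ) (c : ℝ) :
    (M *ᵥ (u + u')) ⬝ᵥ v = (M *ᵥ u) ⬝ᵥ v + (M *ᵥ u') ⬝ᵥ v ∧ (M *ᵥ (c • u)) ⬝ᵥ v = c * ((M *ᵥ u) ⬝ᵥ v)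
    ∧ (M *ᵥ v) ⬝ᵥ (u + u') = (M *ᵥ v) ⬝ᵥ u + (M *ᵥ v) ⬝ᵥ u' ∧ (M *ᵥ v) ⬝ᵥ (c • u) = c * ((M *ᵥ v) ⬝ᵥ u) := by
  refine ⟨by rw [mulVec_add, add_dotProduct], by rw [mulVec_smul, smul_dotProduct, smul_eq_mul],
    by rw [dotProduct_add], by rw [dotProduct_smul, smul_eq_mul]⟩

end Propagators

end Literature.MathematicalPhysics.QuantumFieldTheory.Balaban1983to89.B3Eq119ChargedGraphs
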